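import Mathlib
import Summits.Ventures.PercRepro2.CutFarBA3Count

/-!
# The marks `b` and `a₃` behind an unmarked cut vertex, IV: the three-gadget rule (blind cell
PercRepro2, p3 g3, 2026-08-25; `proofs/P3-BRIDGE.md` §11.9 (b))

From the raw sorting identity of `CutFarBA3Count.lean`: the far counts are orbit-invariant
(`far_swapBA12/13/23`), the `w`-patterns add up to `D = #{o ∈ C_w(c), a₃ ∉ C_w(c)}` and
`E = #{o, a₃ ∈ C_w(c)}` (`far_sums`), and the root-side orbit sums satisfy `O₁′ = O₀`, `O₂′ = O₁`,
`O₃′ = O₂` (`orbit_counts_BA`, from the orbit identities of `CutFarBA3States.lean` through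
`six_mul_typedCount`).  **`typedCount F z τ K₃ = (R₀ · A + R₁ · B + R₂ · C) · (inert)`**
(`typedCount_eq_cutFarBA3`; `R₀, R₁, R₂` the three gadget bases, `A, B, C` the far counts of
`CutFarBA3Count.lean`, all `≥ 0`) — row 2′TRI on the class from the three gadget instances
(`typedCount_nonneg_of_cutFarBA3`).  Own work; standard axioms.
-/

namespace Summit.Ventures.PercRepro2

open UnionCluster

namespace CovForm

namespace RootBridge

open OneTyped TypedA3 Untouched TypedFactor Separated

section Rule

open Classical

variable {V : Type*} {E : Type*} [Fintype E] [DecidableEq E] {R : Type*} [Field R]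
  [LinearOrder R] [IsStrictOrderedRing R]
variable (ends : E → Sym2 V) (o a₁ a₂ a₃ b c : V)


/-- The root count of a pattern, abbreviated. -/
noncomputable def cHb (VH : Set V) (B : Finset E) (z : Config E) (τ : E → ℕ) (bx by_ bw sx sy sw : Bool) : R :=
  typedCount B z τ (hKBA ends o a₁ a₂ c VH bx by_ bw sx sy sw)

/-- The gadget `R₀` = the root-side sum over `O₀` (`b` pendant at `c` by a type-1 edge, `a₃` absent). -/
noncomputable def Rg0 (VH : Set V) (B : Finset E) (z : Config E) (τ : E → ℕ) : R :=
  cHb ends o a₁ a₂ c VH B z τ true false false false false false +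
        cHb ends o a₁ a₂ c VH B z τ false true false false false false +
        cHb ends o a₁ a₂ c VH B z τ false false true false false false

/-- The gadget `R₁` = the root-side sum over `O₁` (= `O₂′`: `c–a₃` of type 2 with `b` pendant at `a₃`). -/
noncomputable def Rg1 (VH : Set V) (B : Finset E) (z : Config E) (τ : E → ℕ) : R :=
  cHb ends o a₁ a₂ c VH B z τ true false false false true false +
        cHb ends o a₁ a₂ c VH B z τ true false false false false true +
        cHb ends o a₁ a₂ c VH B z τ false true false true false false +
        cHb ends o a₁ a₂ c VH B z τ false true false false false true +
        cHb ends o a₁ a₂ c VH B z τ false false true true false false +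
        cHb ends o a₁ a₂ c VH B z τ false false true false true false

/-- The gadget `R₂` = the root-side sum over `O₂` (= `O₃′`: `b` pendant at `c`, `a₃` pinned to `c`). -/
noncomputable def Rg2 (VH : Set V) (B : Finset E) (z : Config E) (τ : E → ℕ) : R :=
  cHb ends o a₁ a₂ c VH B z τ true false false false true true +
        cHb ends o a₁ a₂ c VH B z τ false true false true false true +
        cHb ends o a₁ a₂ c VH B z τ false false true true true false

omit [LinearOrder R] [IsStrictOrderedRing R] in
/-- Six times the root-side sum over the orbit `orbBA0` is the count of its orbit kernel. -/
lemma sixBA_o0 (VH : Set V) (B : Finset E) (z : Config E) (τ : E → ℕ)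
    (hτ : ∀ e ∈ B, τ e = 1 ∨ τ e = 2) :
    (6 : R) * (cHb ends o a₁ a₂ c VH B z τ true false false false false false +
        cHb ends o a₁ a₂ c VH B z τ false true false false false false +
        cHb ends o a₁ a₂ c VH B z τ false false true false false false) =
      typedCount B z τ (fun x y w => ((orbBA0 (rBA ends o a₁ a₂ c VH x) (rBA ends o a₁ a₂ c VH y)
        (rBA ends o a₁ a₂ c VH w) : ℤ) : R)) := by
  have h0 := six_mul_typedCount B z τ hτ (hKBA ends o a₁ a₂ c VH true false false false false false : Config E → Config E → Config E → R)
  have h1 := six_mul_typedCount B z τ hτ (hKBA ends o a₁ a₂ c VH false true false false false false : Config E → Config E → Config E → R)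
  have h2 := six_mul_typedCount B z τ hτ (hKBA ends o a₁ a₂ c VH false false true false false false : Config E → Config E → Config E → R)
  unfold cHb
  rw [mul_add, mul_add, h0, h1, h2, ← typedCount_add', ← typedCount_add']
  refine typedCount_congr' _ _ _ _ _ fun x y w => ?_
  unfold hKBA orbBA0 symBA
  push_cast
  ring

omit [LinearOrder R] [IsStrictOrderedRing R] in
/-- Six times the root-side sum over the orbit `orbBA1` is the count of its orbit kernel. -/
lemma sixBA_o1 (VH : Set V) (B : Finset E) (z : Config E) (τ : E → ℕ)
    (hτ : ∀ e ∈ B, τ e = 1 ∨ τ e = 2) :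
    (6 : R) * (cHb ends o a₁ a₂ c VH B z τ true false false false true false +
        cHb ends o a₁ a₂ c VH B z τ true false false false false true +
        cHb ends o a₁ a₂ c VH B z τ false true false true false false +
        cHb ends o a₁ a₂ c VH B z τ false true false false false true +
        cHb ends o a₁ a₂ c VH B z τ false false true true false false +
        cHb ends o a₁ a₂ c VH B z τ false false true false true false) =
      typedCount B z τ (fun x y w => ((orbBA1 (rBA ends o a₁ a₂ c VH x) (rBA ends o a₁ a₂ c VH y)
        (rBA ends o a₁ a₂ c VH w) : ℤ) : R)) := by
  have h0 := six_mul_typedCount B z τ hτ (hKBA ends o a₁ a₂ c VH true false false false true false : Config E → Config E → Config E → R)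
  have h1 := six_mul_typedCount B z τ hτ (hKBA ends o a₁ a₂ c VH true false false false false true : Config E → Config E → Config E → R)
  have h2 := six_mul_typedCount B z τ hτ (hKBA ends o a₁ a₂ c VH false true false true false false : Config E → Config E → Config E → R)
  have h3 := six_mul_typedCount B z τ hτ (hKBA ends o a₁ a₂ c VH false true false false false true : Config E → Config E → Config E → R)
  have h4 := six_mul_typedCount B z τ hτ (hKBA ends o a₁ a₂ c VH false false true true false false : Config E → Config E → Config E → R)
  have h5 := six_mul_typedCount B z τ hτ (hKBA ends o a₁ a₂ c VH false false true false true false : Config E → Config E → Config E → R)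
  unfold cHb
  rw [mul_add, mul_add, mul_add, mul_add, mul_add, h0, h1, h2, h3, h4, h5, ← typedCount_add', ← typedCount_add', ← typedCount_add', ← typedCount_add', ← typedCount_add']
  refine typedCount_congr' _ _ _ _ _ fun x y w => ?_
  unfold hKBA orbBA1 symBA
  push_cast
  ring

omit [LinearOrder R] [IsStrictOrderedRing R] in
/-- Six times the root-side sum over the orbit `orbBA2` is the count of its orbit kernel. -/
lemma sixBA_o2 (VH : Set V) (B : Finset E) (z : Config E) (τ : E → ℕ)
    (hτ : ∀ e ∈ B, τ e = 1 ∨ τ e = 2) :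
    (6 : R) * (cHb ends o a₁ a₂ c VH B z τ true false false false true true +
        cHb ends o a₁ a₂ c VH B z τ false true false true false true +
        cHb ends o a₁ a₂ c VH B z τ false false true true true false) =
      typedCount B z τ (fun x y w => ((orbBA2 (rBA ends o a₁ a₂ c VH x) (rBA ends o a₁ a₂ c VH y)
        (rBA ends o a₁ a₂ c VH w) : ℤ) : R)) := by
  have h0 := six_mul_typedCount B z τ hτ (hKBA ends o a₁ a₂ c VH true false false false true true : Config E → Config E → Config E → R)
  have h1 := six_mul_typedCount B z τ hτ (hKBA ends o a₁ a₂ c VH false true false true false true : Config E → Config E → Config E → R)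
  have h2 := six_mul_typedCount B z τ hτ (hKBA ends o a₁ a₂ c VH false false true true true false : Config E → Config E → Config E → R)
  unfold cHb
  rw [mul_add, mul_add, h0, h1, h2, ← typedCount_add', ← typedCount_add']
  refine typedCount_congr' _ _ _ _ _ fun x y w => ?_
  unfold hKBA orbBA2 symBA
  push_cast
  ring

omit [LinearOrder R] [IsStrictOrderedRing R] in
/-- Six times the root-side sum over the orbit `orbBA1'` is the count of its orbit kernel. -/
lemma sixBA_o1p (VH : Set V) (B : Finset E) (z : Config E) (τ : E → ℕ)
    (hτ : ∀ e ∈ B, τ e = 1 ∨ τ e = 2) :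
    (6 : R) * (cHb ends o a₁ a₂ c VH B z τ true false false true false false +
        cHb ends o a₁ a₂ c VH B z τ false true false false true false +
        cHb ends o a₁ a₂ c VH B z τ false false true false false true) =
      typedCount B z τ (fun x y w => ((orbBA1' (rBA ends o a₁ a₂ c VH x) (rBA ends o a₁ a₂ c VH y)
        (rBA ends o a₁ a₂ c VH w) : ℤ) : R)) := by
  have h0 := six_mul_typedCount B z τ hτ (hKBA ends o a₁ a₂ c VH true false false true false false : Config E → Config E → Config E → R)
  have h1 := six_mul_typedCount B z τ hτ (hKBA ends o a₁ a₂ c VH false true false false true false : Config E → Config E → Config E → R)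
  have h2 := six_mul_typedCount B z τ hτ (hKBA ends o a₁ a₂ c VH false false true false false true : Config E → Config E → Config E → R)
  unfold cHb
  rw [mul_add, mul_add, h0, h1, h2, ← typedCount_add', ← typedCount_add']
  refine typedCount_congr' _ _ _ _ _ fun x y w => ?_
  unfold hKBA orbBA1' symBA
  push_cast
  ring

omit [LinearOrder R] [IsStrictOrderedRing R] in
/-- Six times the root-side sum over the orbit `orbBA2'` is the count of its orbit kernel. -/
lemma sixBA_o2p (VH : Set V) (B : Finset E) (z : Config E) (τ : E → ℕ)
    (hτ : ∀ e ∈ B, τ e = 1 ∨ τ e = 2) :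
    (6 : R) * (cHb ends o a₁ a₂ c VH B z τ true false false true true false +
        cHb ends o a₁ a₂ c VH B z τ true false false true false true +
        cHb ends o a₁ a₂ c VH B z τ false true false true true false +
        cHb ends o a₁ a₂ c VH B z τ false true false false true true +
        cHb ends o a₁ a₂ c VH B z τ false false true true false true +
        cHb ends o a₁ a₂ c VH B z τ false false true false true true) =
      typedCount B z τ (fun x y w => ((orbBA2' (rBA ends o a₁ a₂ c VH x) (rBA ends o a₁ a₂ c VH y)
        (rBA ends o a₁ a₂ c VH w) : ℤ) : R)) := by
  have h0 := six_mul_typedCount B z τ hτ (hKBA ends o a₁ a₂ c VH true false false true true false : Config E → Config E → Config E → R)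
  have h1 := six_mul_typedCount B z τ hτ (hKBA ends o a₁ a₂ c VH true false false true false true : Config E → Config E → Config E → R)
  have h2 := six_mul_typedCount B z τ hτ (hKBA ends o a₁ a₂ c VH false true false true true false : Config E → Config E → Config E → R)
  have h3 := six_mul_typedCount B z τ hτ (hKBA ends o a₁ a₂ c VH false true false false true true : Config E → Config E → Config E → R)
  have h4 := six_mul_typedCount B z τ hτ (hKBA ends o a₁ a₂ c VH false false true true false true : Config E → Config E → Config E → R)
  have h5 := six_mul_typedCount B z τ hτ (hKBA ends o a₁ a₂ c VH false false true false true true : Config E → Config E → Config E → R)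
  unfold cHb
  rw [mul_add, mul_add, mul_add, mul_add, mul_add, h0, h1, h2, h3, h4, h5, ← typedCount_add', ← typedCount_add', ← typedCount_add', ← typedCount_add', ← typedCount_add']
  refine typedCount_congr' _ _ _ _ _ fun x y w => ?_
  unfold hKBA orbBA2' symBA
  push_cast
  ring

omit [LinearOrder R] [IsStrictOrderedRing R] in
/-- Six times the root-side sum over the orbit `orbBA3'` is the count of its orbit kernel. -/
lemma sixBA_o3p (VH : Set V) (B : Finset E) (z : Config E) (τ : E → ℕ)
    (hτ : ∀ e ∈ B, τ e = 1 ∨ τ e = 2) :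
    (6 : R) * (cHb ends o a₁ a₂ c VH B z τ true false false true true true +
        cHb ends o a₁ a₂ c VH B z τ false true false true true true +
        cHb ends o a₁ a₂ c VH B z τ false false true true true true) =
      typedCount B z τ (fun x y w => ((orbBA3' (rBA ends o a₁ a₂ c VH x) (rBA ends o a₁ a₂ c VH y)
        (rBA ends o a₁ a₂ c VH w) : ℤ) : R)) := by
  have h0 := six_mul_typedCount B z τ hτ (hKBA ends o a₁ a₂ c VH true false false true true true : Config E → Config E → Config E → R)
  have h1 := six_mul_typedCount B z τ hτ (hKBA ends o a₁ a₂ c VH false true false true true true : Config E → Config E → Config E → R)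
  have h2 := six_mul_typedCount B z τ hτ (hKBA ends o a₁ a₂ c VH false false true true true true : Config E → Config E → Config E → R)
  unfold cHb
  rw [mul_add, mul_add, h0, h1, h2, ← typedCount_add', ← typedCount_add']
  refine typedCount_congr' _ _ _ _ _ fun x y w => ?_
  unfold hKBA orbBA3' symBA
  push_cast
  ring

/-- **The orbit counts**: `O₁′ = R₀`, `O₂′ = R₁`, `O₃′ = R₂` (the orbit identities of
`CutFarBA3States.lean` on the valid root bits, through the six-fold symmetrisation). -/
theorem orbit_counts_BA (VH : Set V) (B : Finset E) (z : Config E) (τ : E → ℕ)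
    (hτ : ∀ e ∈ B, τ e = 1 ∨ τ e = 2) :
    (cHb ends o a₁ a₂ c VH B z τ true false false true false false +
        cHb ends o a₁ a₂ c VH B z τ false true false false true false +
        cHb ends o a₁ a₂ c VH B z τ false false true false false true = Rg0 (R := R) ends o a₁ a₂ c VH B z τ) ∧
    (cHb ends o a₁ a₂ c VH B z τ true false false true true false +
        cHb ends o a₁ a₂ c VH B z τ true false false true false true +
        cHb ends o a₁ a₂ c VH B z τ false true false true true false +
        cHb ends o a₁ a₂ c VH B z τ false true false false true true +
        cHb ends o a₁ a₂ c VH B z τ false false true true false true +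
        cHb ends o a₁ a₂ c VH B z τ false false true false true true = Rg1 (R := R) ends o a₁ a₂ c VH B z τ) ∧
    (cHb ends o a₁ a₂ c VH B z τ true false false true true true +
        cHb ends o a₁ a₂ c VH B z τ false true false true true true +
        cHb ends o a₁ a₂ c VH B z τ false false true true true true = Rg2 (R := R) ends o a₁ a₂ c VH B z τ) := by
  have hv := fun x => rBA_valid ends o a₁ a₂ c VH x
  have s0 := sixBA_o0 (R := R) ends o a₁ a₂ c VH B z τ hτ
  have s1 := sixBA_o1 (R := R) ends o a₁ a₂ c VH B z τ hτ
  have s2 := sixBA_o2 (R := R) ends o a₁ a₂ c VH B z τ hτ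
  have s1p := sixBA_o1p (R := R) ends o a₁ a₂ c VH B z τ hτ
  have s2p := sixBA_o2p (R := R) ends o a₁ a₂ c VH B z τ hτ
  have s3p := sixBA_o3p (R := R) ends o a₁ a₂ c VH B z τ hτ
  have ea : typedCount B z τ (fun x y w => ((orbBA1' (rBA ends o a₁ a₂ c VH x) (rBA ends o a₁ a₂ c VH y)
      (rBA ends o a₁ a₂ c VH w) : ℤ) : R)) = typedCount B z τ (fun x y w =>
      ((orbBA0 (rBA ends o a₁ a₂ c VH x) (rBA ends o a₁ a₂ c VH y) (rBA ends o a₁ a₂ c VH w) : ℤ) : R)) := by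
    refine typedCount_congr' _ _ _ _ _ fun x y w => ?_
    rw [orbitBA_a _ _ _ (hv x) (hv y) (hv w)]
  have eb : typedCount B z τ (fun x y w => ((orbBA2' (rBA ends o a₁ a₂ c VH x) (rBA ends o a₁ a₂ c VH y)
      (rBA ends o a₁ a₂ c VH w) : ℤ) : R)) = typedCount B z τ (fun x y w =>
      ((orbBA1 (rBA ends o a₁ a₂ c VH x) (rBA ends o a₁ a₂ c VH y) (rBA ends o a₁ a₂ c VH w) : ℤ) : R)) := by
    refine typedCount_congr' _ _ _ _ _ fun x y w => ?_
    rw [orbitBA_b _ _ _ (hv x) (hv y) (hv w)]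
  have ec : typedCount B z τ (fun x y w => ((orbBA3' (rBA ends o a₁ a₂ c VH x) (rBA ends o a₁ a₂ c VH y)
      (rBA ends o a₁ a₂ c VH w) : ℤ) : R)) = typedCount B z τ (fun x y w =>
      ((orbBA2 (rBA ends o a₁ a₂ c VH x) (rBA ends o a₁ a₂ c VH y) (rBA ends o a₁ a₂ c VH w) : ℤ) : R)) := by
    refine typedCount_congr' _ _ _ _ _ fun x y w => ?_
    rw [orbitBA_c _ _ _ (hv x) (hv y) (hv w)]
  unfold Rg0 Rg1 Rg2
  refine ⟨?_, ?_, ?_⟩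
  · have : (6 : R) ≠ 0 := by norm_num
    apply mul_left_cancel₀ this
    rw [s1p, ea, s0]
  · have : (6 : R) ≠ 0 := by norm_num
    apply mul_left_cancel₀ this
    rw [s2p, eb, s1]
  · have : (6 : R) ≠ 0 := by norm_num
    apply mul_left_cancel₀ this
    rw [s3p, ec, s2]


/-- **THE THREE-GADGET RULE** for `b, a₃` behind an unmarked cut vertex:
`typedCount F z τ K₃ = (R₀ · A + R₁ · B + R₂ · C) · (inert count)`. -/
theorem typedCount_eq_cutFarBA3 {VL VH : Set V} (F : Finset E) (z : Config E) (τ : E → ℕ)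
    (hτ : ∀ e ∈ F, τ e = 1 ∨ τ e = 2) (h : CutFarBA3 ends o a₁ a₂ a₃ b c VL VH F z) :
    typedCount F z τ (K3 ends o a₁ a₂ a₃ b : Config E → Config E → Config E → R) =
      (Rg0 (R := R) ends o a₁ a₂ c VH (sideF ends VH F) z τ * farA (R := R) ends a₃ b c VL (sideF ends VL F) z τ +
        Rg1 (R := R) ends o a₁ a₂ c VH (sideF ends VH F) z τ * farB (R := R) ends a₃ b c VL (sideF ends VL F) z τ +
        Rg2 (R := R) ends o a₁ a₂ c VH (sideF ends VH F) z τ * farC (R := R) ends a₃ b c VL (sideF ends VL F) z τ) *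
        typedCount (F \ (sideF ends VL F ∪ sideF ends VH F)) z τ (fun _ _ _ => (1 : R)) := by
  have hτA : ∀ e ∈ sideF ends VL F, τ e = 1 ∨ τ e = 2 :=
    fun e he => hτ e (Finset.filter_subset _ _ he)
  have hτB : ∀ e ∈ sideF ends VH F, τ e = 1 ∨ τ e = 2 :=
    fun e he => hτ e (Finset.filter_subset _ _ he)
  rw [typedCount_eq_cutFarBA3_raw ends o a₁ a₂ a₃ b c F z τ h]
  rw [far_swapBA13 (R := R) ends a₃ b c VL (sideF ends VL F) z τ hτA true false false false false false,
    far_swapBA13 (R := R) ends a₃ b c VL (sideF ends VL F) z τ hτA true false false true false false,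
    far_swapBA13 (R := R) ends a₃ b c VL (sideF ends VL F) z τ hτA true false false false true false,
    far_swapBA13 (R := R) ends a₃ b c VL (sideF ends VL F) z τ hτA true false false false false true,
    far_swapBA13 (R := R) ends a₃ b c VL (sideF ends VL F) z τ hτA true false false true true false,
    far_swapBA13 (R := R) ends a₃ b c VL (sideF ends VL F) z τ hτA true false false true false true,
    far_swapBA13 (R := R) ends a₃ b c VL (sideF ends VL F) z τ hτA true false false false true true,
    far_swapBA13 (R := R) ends a₃ b c VL (sideF ends VL F) z τ hτA true false false true true true]
  rw [far_swapBA23 (R := R) ends a₃ b c VL (sideF ends VL F) z τ hτA false true false false false false,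
    far_swapBA23 (R := R) ends a₃ b c VL (sideF ends VL F) z τ hτA false true false true false false,
    far_swapBA23 (R := R) ends a₃ b c VL (sideF ends VL F) z τ hτA false true false false true false,
    far_swapBA23 (R := R) ends a₃ b c VL (sideF ends VL F) z τ hτA false true false false false true,
    far_swapBA23 (R := R) ends a₃ b c VL (sideF ends VL F) z τ hτA false true false true true false,
    far_swapBA23 (R := R) ends a₃ b c VL (sideF ends VL F) z τ hτA false true false true false true,
    far_swapBA23 (R := R) ends a₃ b c VL (sideF ends VL F) z τ hτA false true false false true true,
    far_swapBA23 (R := R) ends a₃ b c VL (sideF ends VL F) z τ hτA false true false true true true]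
  have e12 := far_swapBA12 (R := R) ends a₃ b c VL (sideF ends VL F) z τ false false true true false false
  have e12' := far_swapBA12 (R := R) ends a₃ b c VL (sideF ends VL F) z τ false false true true false true
  obtain ⟨hA, hB, hC⟩ := far_sums_BA (R := R) ends a₃ b c VL (sideF ends VL F) z τ
  obtain ⟨hoA, hoB, hoC⟩ := orbit_counts_BA (R := R) ends o a₁ a₂ c VH (sideF ends VH F) z τ hτB
  unfold Rg0 Rg1 Rg2 at *
  unfold cHb at *
  linear_combination typedCount (F \ (sideF ends VL F ∪ sideF ends VH F)) z τ (fun _ _ _ => (1 : R)) *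
    (typedCount (sideF ends VL F) z τ (lKBA3 ends a₃ b c VL false false true false false true) * hoA + typedCount (sideF ends VL F) z τ (lKBA3 ends a₃ b c VL false false true true false true) * hoB +
      typedCount (sideF ends VL F) z τ (lKBA3 ends a₃ b c VL false false true true true true) * hoC -
      (typedCount (sideF ends VH F) z τ (hKBA ends o a₁ a₂ c VH true false false false true false) + typedCount (sideF ends VH F) z τ (hKBA ends o a₁ a₂ c VH false true false false false true) + typedCount (sideF ends VH F) z τ (hKBA ends o a₁ a₂ c VH false false true false true false)) * e12 - (typedCount (sideF ends VH F) z τ (hKBA ends o a₁ a₂ c VH true false false true true false) + typedCount (sideF ends VH F) z τ (hKBA ends o a₁ a₂ c VH false true false false true true) + typedCount (sideF ends VH F) z τ (hKBA ends o a₁ a₂ c VH false false true false true true)) * e12' +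
      (typedCount (sideF ends VH F) z τ (hKBA ends o a₁ a₂ c VH true false false false false false) + typedCount (sideF ends VH F) z τ (hKBA ends o a₁ a₂ c VH false true false false false false) + typedCount (sideF ends VH F) z τ (hKBA ends o a₁ a₂ c VH false false true false false false)) * hA + (typedCount (sideF ends VH F) z τ (hKBA ends o a₁ a₂ c VH true false false false true false) + typedCount (sideF ends VH F) z τ (hKBA ends o a₁ a₂ c VH true false false false false true) + typedCount (sideF ends VH F) z τ (hKBA ends o a₁ a₂ c VH false true false true false false) + typedCount (sideF ends VH F) z τ (hKBA ends o a₁ a₂ c VH false true false false false true) + typedCount (sideF ends VH F) z τ (hKBA ends o a₁ a₂ c VH false false true true false false) + typedCount (sideF ends VH F) z τ (hKBA ends o a₁ a₂ c VH false false true false true false)) * hB + (typedCount (sideF ends VH F) z τ (hKBA ends o a₁ a₂ c VH true false false false true true) + typedCount (sideF ends VH F) z τ (hKBA ends o a₁ a₂ c VH false true false true false true) + typedCount (sideF ends VH F) z τ (hKBA ends o a₁ a₂ c VH false false true true true false)) * hC)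

/-- **Row 2′TRI when `b` and `a₃` sit behind an unmarked cut vertex** follows from row 2′TRI on the
three gadget instances `R₀`, `R₁`, `R₂`. -/
theorem typedCount_nonneg_of_cutFarBA3 {VL VH : Set V} (F : Finset E) (z : Config E) (τ : E → ℕ)
    (hτ : ∀ e ∈ F, τ e = 1 ∨ τ e = 2) (h : CutFarBA3 ends o a₁ a₂ a₃ b c VL VH F z)
    (h0 : 0 ≤ Rg0 (R := R) ends o a₁ a₂ c VH (sideF ends VH F) z τ)
    (h1 : 0 ≤ Rg1 (R := R) ends o a₁ a₂ c VH (sideF ends VH F) z τ)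
    (h2 : 0 ≤ Rg2 (R := R) ends o a₁ a₂ c VH (sideF ends VH F) z τ) :
    0 ≤ typedCount F z τ (K3 ends o a₁ a₂ a₃ b : Config E → Config E → Config E → R) := by
  rw [typedCount_eq_cutFarBA3 ends o a₁ a₂ a₃ b c F z τ hτ h]
  have hA : (0 : R) ≤ farA (R := R) ends a₃ b c VL (sideF ends VL F) z τ := by
    unfold farA
    refine typedCount_nonneg_of_nonneg _ _ _ fun x y w => ?_
    unfold indBA
    split_ifs <;> simp
  have hB : (0 : R) ≤ farB (R := R) ends a₃ b c VL (sideF ends VL F) z τ := by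
    unfold farB
    refine typedCount_nonneg_of_nonneg _ _ _ fun x y w => ?_
    unfold indBA
    split_ifs <;> simp
  have hC : (0 : R) ≤ farC (R := R) ends a₃ b c VL (sideF ends VL F) z τ := by
    unfold farC
    refine typedCount_nonneg_of_nonneg _ _ _ fun x y w => ?_
    unfold indBA
    split_ifs <;> simp
  have hI : (0 : R) ≤ typedCount (F \ (sideF ends VL F ∪ sideF ends VH F)) z τ
      (fun _ _ _ => (1 : R)) :=
    typedCount_nonneg_of_nonneg _ _ _ fun _ _ _ => zero_le_one
  exact mul_nonneg (add_nonneg (add_nonneg (mul_nonneg h0 hA) (mul_nonneg h1 hB)) (mul_nonneg h2 hC)) hI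

end Rule

end RootBridge

end CovForm

end Summit.Ventures.PercRepro2
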